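import Literature.Topology.FourManifolds.CappellShanesonIdealCertificates
import HarnessLib

/-!
# Trace `57`: two-ideal relations with certified generators (2 of 2)

Part 'Rel2' of the certified class-group computation for the trace `57` field behind
Kim–Yamada's Theorem B (`GompfConjectureForTrace 57` and, by Theorem A, `-52`), serving the
named fact
`Literature.Topology.FourManifolds.kimYamada2023_nonempty_diffeomorph_sphere_four_of_trace_mem_Icc`
(`CappellShaneson.lean`; M. H. Kim, S. Yamada, Kyungpook Math. J. 63 (2023) 373–411 =
arXiv:1707.03860, Cor. C). The computation is split over several files only because of the
proposal size limit: `…ClassGroupFiftyseven.lean` (discriminant, `𝓞 K = ℤ[θ]`, the primes of small norm), `…ClassGroupFiftysevenRel<k>.lean` (two-ideal relations with certified generators and the non-vanishing of the generators), `…ClassGroupFiftysevenCls.lean` (the class of every small prime in terms of the generator(s), the order relations), `…ClassGroupFiftysevenMain.lean` (generation of the class group by Minkowski's bound, the cover of `C(ℤ[Θ])` by standard-matrix representatives, Gompf's conjecture for the two traces). (File generated from a certified computation; every relation is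
checked by the Lean kernel; no named fact is introduced, D-0026.)

## References

* [KimYamada2023] M. H. Kim, S. Yamada, Kyungpook Math. J. 63 (2023) 373–411 (arXiv:1707.03860):
  §2.3 (Prop. 2.14), §6.1 (Lemma 6.1 and the proof of Thm. B), Thm. A.
* [Marcus2018] D. A. Marcus, *Number Fields*, 2nd ed., Ch. 3, Thm. 27 (Dedekind–Kummer); Ch. 5,
  Cor. 2 of Thm. 37 (Minkowski bound) and the class-group computations after it.
-/

noncomputable section

open Set Polynomial Module NumberField Ideal
open scoped NumberField MatrixGroups nonZeroDivisors
open Literature.LinearAlgebra.Matrix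

namespace Literature.Topology.FourManifolds

section Field

variable {K : Type*} [Field K] [NumberField K] {θ : K}

/-! ### Relations among the small primes of the trace `57` field: explicit generators -/

/-- `2 * θ ^ 2 - 10 * θ - 25 ≠ 0` in `𝓞 K` (it divides `4709843`). [folklore] -/
theorem ne124_fiftyseven (hθ : aeval θ (csPoly 57) = 0) : 2 * thetaInt hθ ^ 2 - 10 * thetaInt hθ - 25 ≠ 0 := by
  have rel := thetaInt_rel hθ
  push_cast at rel
  set t := thetaInt hθ with ht
  intro h0
  have key : (2 * t ^ 2 - 10 * t - 25) * (-766 * t ^ 2 + 46266 * t - 187879) = (4709843 : 𝓞 K) := by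
    linear_combination (-1532 * t + 12868) * rel
  rw [h0, zero_mul] at key
  norm_num at key

/-- `θ + 12 ≠ 0` in `𝓞 K` (it divides `10609`). [folklore] -/
theorem ne125_fiftyseven (hθ : aeval θ (csPoly 57) = 0) : thetaInt hθ + 12 ≠ 0 := by
  have rel := thetaInt_rel hθ
  push_cast at rel
  set t := thetaInt hθ with ht
  intro h0
  have key : (t + 12) * (t ^ 2 - 69 * t + 884) = (10609 : 𝓞 K) := by
    linear_combination (1 : 𝓞 K) * rel
  rw [h0, zero_mul] at key
  norm_num at key

end Field

end Literature.Topology.FourManifolds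

end
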